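import Summits.QuantumFields.QCD.Theorems.EulerDescentHonestHeavyAnchorRaySplit

/-!
# `EulerDescent.HonestHeavyAnchor` (stmt-QuantumFields-16901) WITHOUT the corner: the SQUEEZED THRESHOLD form

Lead file (line `bounded_locator`, cycle 2, lead `prover-line-stmt-QuantumFields-16901-c1-0`).  The crux quantifies over an
auxiliary corner sequence `mc` and asks (i) `∀ᶠ k, IsLUB NonMassive(β_k) (mc k)`, (ii) the RGI pin
`(m_crit(k) − mc(k))·Z_m(k)/a_k → 0`, besides mass scaling, asymptotic scaling, the branch `−1 < m_crit`, and the heavy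
body.  This file ELIMINATES `mc`, the least-upper-bound clause and the pin:

`honestHeavyAnchor_iff_squeezedThreshold : HonestHeavyAnchor ↔ SQUEEZE`, where SQUEEZE says, for `N_f ∈ {2,3}`, that
some mass-scaling, asymptotically scaling regularisation on the branch `−1 < m_crit` carries the heavy body above some
`M_h > 0` AND its critical mass is squeezed by its own lattice theories from both sides at EVERY positive RGI scale:

* for every `M' > 0`, eventually in `k`, EVERY degenerate bare mass `μ ≥ m_crit(k) + a_k M'/Z_m(k)` is massive at `β_k`
  (the massive ray above, at every positive RGI height);
* for every `C > 0`, eventually in `k`, SOME degenerate bare mass `μ ≥ m_crit(k) − a_k C/Z_m(k)` is non-massive at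
  `β_k` (a non-massive point below, within every positive RGI depth).

So the crux is exactly "`ThresholdQCD` (stmt-8794) for a regularisation whose critical mass is, to `o(a_k/Z_m(k))`, the
TOP of the non-massive set of its own lattice theories, on the physical branch" — no corner sequence, no supremum, no
re-pinning, no Bolzano–Weierstrass.  `→`: the pin puts `m_crit ± (const)·a/Z_m` eventually on either side of the least
upper bound (`massive_ray_of_corner_of_pin`, `nonMassive_below_of_corner_of_pin`, the witness kept FIXED — the earlier
necessity lemmas `HonestHeavyAnchorLowerLocator.massive_rays_of_honestHeavyAnchor` and
`HonestHeavyAnchorRaySplit.nonMassive_below_of_honestHeavyAnchor` re-extract a regularisation each and lose the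
conjunction).  `←`: `mc k := sSup NonMassive(β_k)` is eventually a least upper bound (non-empty by the depth-`1` point,
bounded by the height-`1` ray: `HonestHeavyAnchorIntrinsicCorner.isLUB_sSup_of_mem_of_barrier`), and the two families
squeeze the offset into `[−M', C]` for all `M', C > 0`, i.e. the pin holds for THIS `m_crit` (`tendsto_zero_of_forall_eventually_abs_le`).

Consequence for the line (rev 3 = S1/T/U/R over `honestHeavyAnchor_of_threshold_of_branchTransition_of_rays`): the
registered stubs U (`stub_uniformlyMassiveAboveOfBody`, ONE height `M'`) and R (`stub_nonMassiveBelowOfBody`, ONE depth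
`C`) are the single-scale shadows of the two squeeze families; the glue manufactures all scales by re-pinning at a
subsequential limit of the offset, which is where the fixed-coupling transition T is spent (to keep the re-pinned
critical mass above `−1`).  Pure order/filter bookkeeping over `QCDOS.lean`; standard axioms; no `def` (the non-massive
set, the massive predicate and the body are inlined verbatim as in the route file).
-/

namespace Summit.QuantumFields.QCD.Theorems.HonestHeavyAnchorSqueeze

open Filter Topology
open Literature.MathematicalPhysics.QuantumFieldTheory
open Summit.QuantumFields.QCD.Theses
open Summit.QuantumFields.QCD.Theorems.HonestHeavyAnchorIntrinsicCorner (isLUB_sSup_of_mem_of_barrier)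
open Summit.QuantumFields.QCD.Theorems.HonestHeavyAnchorLowerLocator (corner_le_ray_iff)
open Summit.QuantumFields.QCD.Theorems.HonestHeavyAnchorRaySplit (ray_below_le_corner_iff)

variable {Nf : ℕ}

/-- A real sequence which, for every `ε > 0`, is eventually in `[−ε, ε]` tends to `0`. [folklore] -/
theorem tendsto_zero_of_forall_eventually_abs_le (x : ℕ → ℝ)
    (h : ∀ ε : ℝ, 0 < ε → ∀ᶠ k in atTop, -ε ≤ x k ∧ x k ≤ ε) : Tendsto x atTop (𝓝 0) := by
  rw [Metric.tendsto_nhds]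
  intro ε hε
  filter_upwards [h (ε / 2) (half_pos hε)] with k hk
  rw [Real.dist_eq, sub_zero, abs_lt]
  constructor <;> linarith [hk.1, hk.2]

/-- `m_crit(k) + a_k M'/Z_m(k) ≤ c` iff `(m_crit(k) − c)·Z_m(k)/a_k ≤ −M'` (`a_k, Z_m(k) > 0`). [folklore] -/
theorem ray_above_le_iff (reg : QCDRegularisation Nf) (c M' : ℝ) (k : ℕ) :
    reg.mcrit k + reg.a k * M' / reg.Zm k ≤ c ↔ (reg.mcrit k - c) * reg.Zm k / reg.a k ≤ -M' := by
  have ha := reg.a_pos k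
  have hZ := reg.Zm_pos k
  rw [div_le_iff₀ ha, ← le_sub_iff_add_le', div_le_iff₀ hZ]
  constructor <;> intro h <;> nlinarith [h]

/-- `c < m_crit(k) − a_k C/Z_m(k)` iff `C < (m_crit(k) − c)·Z_m(k)/a_k` (`a_k, Z_m(k) > 0`). [folklore] -/
theorem lt_ray_below_iff (reg : QCDRegularisation Nf) (c C : ℝ) (k : ℕ) :
    c < reg.mcrit k - reg.a k * C / reg.Zm k ↔ C < (reg.mcrit k - c) * reg.Zm k / reg.a k := by
  rw [← not_le, ← not_le, ray_below_le_corner_iff]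

/-- **Corner + pin ⇒ the massive ray above at every positive RGI height, for the SAME regularisation.**  If eventually
`mc k` is the least upper bound of the sets `N k` and `(m_crit(k) − mc(k))·Z_m(k)/a_k → 0`, then for every `M' > 0`,
eventually every `μ ≥ m_crit(k) + a_k M'/Z_m(k)` lies outside `N k` (the offset is eventually `> −M'`, so the foot of the
ray is strictly above the least upper bound). [folklore] -/
theorem massive_ray_of_corner_of_pin (reg : QCDRegularisation Nf) (N : ℕ → Set ℝ) (mc : ℕ → ℝ)
    (hcorner : ∀ᶠ k in atTop, IsLUB (N k) (mc k))
    (hpin : Tendsto (fun k => (reg.mcrit k - mc k) * reg.Zm k / reg.a k) atTop (𝓝 0)) {M' : ℝ} (hM' : 0 < M') :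
    ∀ᶠ k in atTop, ∀ μ : ℝ, reg.mcrit k + reg.a k * M' / reg.Zm k ≤ μ → μ ∉ N k := by
  filter_upwards [hcorner, hpin.eventually_const_lt (neg_lt_zero.2 hM')] with k hk hlt μ hμ hμN
  -- `mc k < m_crit(k) + a_k M'/Z_m(k) ≤ μ`, contradicting `μ ≤ mc k`
  have h1 : ¬ reg.mcrit k + reg.a k * M' / reg.Zm k ≤ mc k := fun h =>
    absurd ((ray_above_le_iff reg (mc k) M' k).1 h) (not_le.2 hlt)
  exact h1 (hμ.trans (hk.1 hμN))

/-- **Corner + pin ⇒ a non-massive point below within every positive RGI depth, for the SAME regularisation.**  If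
eventually `mc k` is the least upper bound of `N k` and the offset tends to `0`, then for every `C > 0`, eventually some
`μ ∈ N k` satisfies `m_crit(k) − a_k C/Z_m(k) ≤ μ` (the offset is eventually `< C`, so that bare mass is strictly below the
least upper bound, and `IsLUB.exists_between` applies). [folklore] -/
theorem nonMassive_below_of_corner_of_pin (reg : QCDRegularisation Nf) (N : ℕ → Set ℝ) (mc : ℕ → ℝ)
    (hcorner : ∀ᶠ k in atTop, IsLUB (N k) (mc k))
    (hpin : Tendsto (fun k => (reg.mcrit k - mc k) * reg.Zm k / reg.a k) atTop (𝓝 0)) {C : ℝ} (hC : 0 < C) :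
    ∀ᶠ k in atTop, ∃ μ : ℝ, reg.mcrit k - reg.a k * C / reg.Zm k ≤ μ ∧ μ ∈ N k := by
  filter_upwards [hcorner, hpin.eventually_lt_const hC] with k hk hlt
  have hlt' : reg.mcrit k - reg.a k * C / reg.Zm k < mc k := by
    have ha := reg.a_pos k
    have hZ := reg.Zm_pos k
    rw [div_lt_iff₀ ha] at hlt
    rw [sub_lt_comm, lt_div_iff₀ hZ]
    nlinarith [hlt]
  obtain ⟨μ, hμN, hμgt, -⟩ := hk.exists_between hlt'
  exact ⟨μ, hμgt.le, hμN⟩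

/-- **Squeeze ⇒ corner and pin.**  If eventually some member of `N k` lies above `m_crit(k) − a_k C/Z_m(k)` for every
`C > 0`, and eventually every `μ ≥ m_crit(k) + a_k M'/Z_m(k)` lies outside `N k` for every `M' > 0`, then `sSup (N k)` is
eventually the least upper bound of `N k` and the offset `(m_crit(k) − sSup (N k))·Z_m(k)/a_k` tends to `0`. [folklore] -/
theorem corner_and_pin_of_squeeze (reg : QCDRegularisation Nf) (N : ℕ → Set ℝ)
    (hU : ∀ M' : ℝ, 0 < M' → ∀ᶠ k in atTop, ∀ μ : ℝ, reg.mcrit k + reg.a k * M' / reg.Zm k ≤ μ → μ ∉ N k)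
    (hR : ∀ C : ℝ, 0 < C → ∀ᶠ k in atTop, ∃ μ : ℝ, reg.mcrit k - reg.a k * C / reg.Zm k ≤ μ ∧ μ ∈ N k) :
    (∀ᶠ k in atTop, IsLUB (N k) (sSup (N k))) ∧
      Tendsto (fun k => (reg.mcrit k - sSup (N k)) * reg.Zm k / reg.a k) atTop (𝓝 0) := by
  -- at scale `ε`: the supremum is a least upper bound, sandwiched between depth `ε` and height `ε`
  have hsand : ∀ ε : ℝ, 0 < ε → ∀ᶠ k in atTop, IsLUB (N k) (sSup (N k)) ∧
      reg.mcrit k - reg.a k * ε / reg.Zm k ≤ sSup (N k) ∧ sSup (N k) ≤ reg.mcrit k + reg.a k * ε / reg.Zm k := by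
    intro ε hε
    filter_upwards [hU ε hε, hR ε hε] with k hk₁ hk₂
    obtain ⟨μ, hμge, hμN⟩ := hk₂
    obtain ⟨hlub, hμle, hle⟩ := isLUB_sSup_of_mem_of_barrier (N k) μ _ hμN hk₁
    exact ⟨hlub, hμge.trans hμle, hle⟩
  refine ⟨(hsand 1 one_pos).mono fun k hk => hk.1, tendsto_zero_of_forall_eventually_abs_le _ fun ε hε => ?_⟩
  filter_upwards [hsand ε hε] with k hk
  exact ⟨(corner_le_ray_iff reg (sSup (N k)) ε k).1 hk.2.2, (ray_below_le_corner_iff reg (sSup (N k)) ε k).1 hk.2.1⟩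

/-- **`HonestHeavyAnchor` ⟺ the SQUEEZED THRESHOLD** (module docstring): the crux BY NAME is equivalent to the existence,
for `N_f ∈ {2,3}`, of a mass-scaling, asymptotically scaling regularisation on the branch `−1 < m_crit` carrying the heavy
body above some `M_h > 0`, whose own lattice theories are massive on the ray above `m_crit(k) + a_k M'/Z_m(k)` eventually
for EVERY `M' > 0` and have a non-massive degenerate bare mass above `m_crit(k) − a_k C/Z_m(k)` eventually for EVERY
`C > 0`.  No corner sequence, no least upper bound, no pin appear on the right. [folklore] -/
theorem honestHeavyAnchor_iff_squeezedThreshold :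
    EulerDescent.HonestHeavyAnchor ↔
    ∀ Nf : ℕ, Nf = 2 ∨ Nf = 3 → ∃ (reg : QCDRegularisation Nf) (Mh : ℝ),
      reg.HasMassScaling ∧ (reg.scheme 0 0 0).HasAsymptoticScaling ∧ (∀ᶠ k in atTop, (-1 : ℝ) < reg.mcrit k) ∧
      0 < Mh ∧
      (∀ m : Fin Nf → ℝ, (∀ f, Mh ≤ m f) → ∃ (z shift : QCDField Nf → ℕ → ℝ) (T : OSData (QCDField Nf) 4),
        IsQCDAlong (reg.scheme m z shift) T ∧ T.IsNontrivial QCDField.glue ∧ T.IsNonGaussian QCDField.glue ∧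
          (∀ f g : Fin Nf, f ≠ g → T.IsNontrivial (QCDField.pseudoRe f g)) ∧
            ∃ Δ > 0, T.HasMassGap Δ ∧ (reg.scheme m z shift).HasLatticeMassGap Δ) ∧
      (∀ M' : ℝ, 0 < M' → ∀ᶠ k in atTop, ∀ μ : ℝ, reg.mcrit k + reg.a k * M' / reg.Zm k ≤ μ →
        ∀ (R R' : ℕ) (A : QCDLatticeObservable Nf R) (B : QCDLatticeObservable Nf R'), ∃ (C δ : ℝ) (S₀ : ℕ),
          0 < δ ∧ ∀ S : ℕ, S₀ ≤ S → ∀ n : ℕ, n ≤ S →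
            ‖qcdLatticeConnectedCorr (reg.β k) (2 * S + 1) (fun _ : Fin Nf => μ) A B n‖ ≤ C * Real.exp (-(δ * n))) ∧
      (∀ C : ℝ, 0 < C → ∀ᶠ k in atTop, ∃ μ : ℝ, reg.mcrit k - reg.a k * C / reg.Zm k ≤ μ ∧
        ¬ (∀ (R R' : ℕ) (A : QCDLatticeObservable Nf R) (B : QCDLatticeObservable Nf R'), ∃ (C δ : ℝ) (S₀ : ℕ),
          0 < δ ∧ ∀ S : ℕ, S₀ ≤ S → ∀ n : ℕ, n ≤ S →
            ‖qcdLatticeConnectedCorr (reg.β k) (2 * S + 1) (fun _ : Fin Nf => μ) A B n‖ ≤ C * Real.exp (-(δ * n)))) := by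
  constructor
  · intro h Nf hNf
    obtain ⟨reg, mc, Mh, hcorner, hpin, hms, haf, hbr, hMh, hbody⟩ := h Nf hNf
    refine ⟨reg, Mh, hms, haf, hbr, hMh, hbody, fun M' hM' => ?_, fun C hC => ?_⟩
    · filter_upwards [massive_ray_of_corner_of_pin reg _ mc hcorner hpin hM'] with k hk μ hμ
      -- outside the non-massive set means massive
      exact not_not.1 (hk μ hμ)
    · exact nonMassive_below_of_corner_of_pin reg _ mc hcorner hpin hC
  · intro h Nf hNf
    obtain ⟨reg, Mh, hms, haf, hbr, hMh, hbody, hU, hR⟩ := h Nf hNf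
    set N : ℕ → Set ℝ := fun k => {μ : ℝ | ¬ (∀ (R R' : ℕ) (A : QCDLatticeObservable Nf R)
        (B : QCDLatticeObservable Nf R'), ∃ (C δ : ℝ) (S₀ : ℕ), 0 < δ ∧ ∀ S : ℕ, S₀ ≤ S → ∀ n : ℕ, n ≤ S →
          ‖qcdLatticeConnectedCorr (reg.β k) (2 * S + 1) (fun _ : Fin Nf => μ) A B n‖ ≤ C * Real.exp (-(δ * n)))}
      with hN
    have hU' : ∀ M' : ℝ, 0 < M' → ∀ᶠ k in atTop, ∀ μ : ℝ, reg.mcrit k + reg.a k * M' / reg.Zm k ≤ μ → μ ∉ N k :=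
      fun M' hM' => (hU M' hM').mono fun k hk μ hμ hμN => hμN (hk μ hμ)
    have hR' : ∀ C : ℝ, 0 < C → ∀ᶠ k in atTop, ∃ μ : ℝ, reg.mcrit k - reg.a k * C / reg.Zm k ≤ μ ∧ μ ∈ N k :=
      fun C hC => (hR C hC).mono fun k ⟨μ, hμ, hμN⟩ => ⟨μ, hμ, hμN⟩
    obtain ⟨hcorner, hpin⟩ := corner_and_pin_of_squeeze reg N hU' hR'
    exact ⟨reg, fun k => sSup (N k), Mh, hcorner, hpin, hms, haf, hbr, hMh, hbody⟩

end Summit.QuantumFields.QCD.Theorems.HonestHeavyAnchorSqueeze
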